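import Summits.ResolutionOfSingularities.KangarooAtlas.MizutaniBoxWeight
import HarnessLib

/-!
# The truncated heat operator `∂σ² − w ∂u` on `K[u, σ]/(u^p, σ^p)` and its perturbations: kernel of dimension `≤ p`

Cell topic `Summits/ResolutionOfSingularities/KangarooAtlas` (pub-rosobs); namespace
`Summit.ResolutionOfSingularities.KangarooAtlas.Mizutani`.  Part of the Lean transcription of Mizutani 1973 §2
around the in-house note MIZUTANI-PROOF-g59 (AI-written, AI-audited; *AI review is weaker than expert review*; not a
resolution theorem).  The computational core of the «degenerate symbol, `w ≠ 0`» case of the equality part of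
Mizutani's Lemma 2.9 (not spelled out in print: «complicated calculations», p. 94): on `B = K[X₀, X₁]/(X₀^p, X₁^p)`
with weights `ω = (2, 1)` (`X₀ = u`, `X₁ = σ`),

* `heatOp w = ∂₁ ∘ ∂₁ − w·∂₀` (`w ∈ K`), weighted-homogeneous of degree `−2`; **`eq_zero_of_heatOp_eq_zero`** — an
  element of `ker (heatOp w)` (`w ≠ 0`) all of whose coefficients at the monomials `σ^j` vanish is zero (the recursion
  `(j+2)(j+1) g_{i,j+2} = w (i+1) g_{i+1,j}`);
* `heatPert ε ŵ = (∂₁ + ε∂₀)² − ŵ ∂₀` with `ε` of weight `≥ 2` and `ŵ − w` of weight `≥ 1`: its leading part is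
  `heatOp w`, so by initial forms (`finrank_ker_le_card_of_initialForm`) **`finrank_ker_heatPert_le`**:
  `dim_K ker (heatPert ε ŵ) ≤ p`.

References: [Mizutani1973HironakaGroupSchemes] Lemma 2.9 (2), p. 93–94; folklore.
-/

open MvPolynomial Literature.AlgebraicGeometry.Resolution

namespace Summit.ResolutionOfSingularities.KangarooAtlas.Mizutani

section Heat

variable {K : Type*} [Field K] {p : ℕ} [CharP K p]

/-- `(n : K) ≠ 0` for `0 < n < p`. [folklore] -/
theorem natCast_ne_zero_of_lt {n : ℕ} (hn : 0 < n) (hnp : n < p) : (n : K) ≠ 0 := by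
  intro h0
  rw [CharP.cast_eq_zero_iff K p] at h0
  exact absurd (Nat.le_of_dvd hn h0) (not_le.mpr hnp)

/-- The weights `(2, 1)`: `u = X₀` has weight `2`, `σ = X₁` has weight `1`. [folklore] -/
def heatWeight : Fin 2 → ℕ := ![2, 1]

/-- `u` has weight `2`. [folklore] -/
@[simp] theorem heatWeight_zero : heatWeight 0 = 2 := rfl

/-- `σ` has weight `1`. [folklore] -/
@[simp] theorem heatWeight_one : heatWeight 1 = 1 := rfl

variable (K p) in
/-- **The truncated heat operator** `∂₁ ∘ ∂₁ − w·∂₀` on `K[X₀,X₁]/(X^p)`. [folklore] -/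
noncomputable def heatOp (w : K) : BoxQuot (Fin 2) K (p ^ 1) →ₗ[K] BoxQuot (Fin 2) K (p ^ 1) :=
  boxDeriv K 2 (p ^ 1) 1 ∘ₗ boxDeriv K 2 (p ^ 1) 1 -
    LinearMap.mulLeft K (Ideal.Quotient.mk (boxIdeal (Fin 2) K (p ^ 1)) (C w)) ∘ₗ boxDeriv K 2 (p ^ 1) 0

omit [CharP K p] in
/-- `heatOp` unfolded. [folklore] -/
theorem heatOp_apply (w : K) (z : BoxQuot (Fin 2) K (p ^ 1)) :
    heatOp K p w z = boxDeriv K 2 (p ^ 1) 1 (boxDeriv K 2 (p ^ 1) 1 z) -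
      Ideal.Quotient.mk _ (C w) * boxDeriv K 2 (p ^ 1) 0 z := rfl

/-! ### Coefficient formulas -/

/-- Second derivative in `X_i`: `coeff_N (∂_i∂_i g) = coeff_{N + 2e_i} g · (N_i+2)(N_i+1)` for `N` in the box. [folklore] -/
theorem coeff_truncQ_boxDeriv_boxDeriv (i : Fin 2) (g : BoxQuot (Fin 2) K (p ^ 1)) (N : Fin 2 →₀ ℕ) (hN : InBox (p ^ 1) N) :
    coeff N (truncQ (Fin 2) K (p ^ 1) (boxDeriv K 2 (p ^ 1) i (boxDeriv K 2 (p ^ 1) i g))) =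
      coeff (N + Finsupp.single i 2) (truncQ (Fin 2) K (p ^ 1) g) * ((N i + 2) * (N i + 1)) := by
  rw [coeff_truncQ_boxDeriv le_rfl i _ N hN]
  by_cases hN' : InBox (p ^ 1) (N + Finsupp.single i 1)
  · rw [coeff_truncQ_boxDeriv le_rfl i _ _ hN', add_assoc, ← Finsupp.single_add, Finsupp.add_apply,
      Finsupp.single_eq_same]
    push_cast
    ring
  · rw [coeff_truncQ_eq_zero_of_not_inBox _ hN', zero_mul, coeff_truncQ_eq_zero_of_not_inBox, zero_mul]
    intro hbox
    apply hN'
    intro k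
    have := hbox k
    rw [Finsupp.add_apply] at this ⊢
    rw [Finsupp.single_apply] at this ⊢
    split_ifs at this ⊢ <;> omega

/-- The coefficient relation of `heatOp w g = 0`: `(j+2)(j+1) g_{N+2e₁} = w (N₀+1) g_{N+e₀}`. [folklore] -/
theorem coeff_rel_of_heatOp_eq_zero {w : K} {g : BoxQuot (Fin 2) K (p ^ 1)} (hg : heatOp K p w g = 0)
    (N : Fin 2 →₀ ℕ) (hN : InBox (p ^ 1) N) :
    coeff (N + Finsupp.single 1 2) (truncQ (Fin 2) K (p ^ 1) g) * ((N 1 + 2) * (N 1 + 1)) =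
      w * (coeff (N + Finsupp.single 0 1) (truncQ (Fin 2) K (p ^ 1) g) * (N 0 + 1)) := by
  have := congrArg (fun z => coeff N (truncQ (Fin 2) K (p ^ 1) z)) hg
  simp only [heatOp_apply, map_sub, map_zero, coeff_sub, coeff_zero, truncQ_C_mul, coeff_C_mul] at this
  rw [coeff_truncQ_boxDeriv_boxDeriv 1 g N hN, coeff_truncQ_boxDeriv le_rfl 0 _ N hN] at this
  exact sub_eq_zero.mp this

/-- **Injectivity of the `σ`-coefficients on `ker (heatOp w)`** (`w ≠ 0`): if `heatOp w g = 0` and the coefficients of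
`g` at all `σ^j = X₁^j` vanish, then `g = 0` (induction on the `X₀`-degree). [folklore] -/
theorem eq_zero_of_heatOp_eq_zero {w : K} (hw : w ≠ 0) {g : BoxQuot (Fin 2) K (p ^ 1)} (hg : heatOp K p w g = 0)
    (h0 : ∀ j : ℕ, j < p → coeff (Finsupp.single 1 j) (truncQ (Fin 2) K (p ^ 1) g) = 0) : g = 0 := by
  have hp1 : p ^ 1 = p := pow_one p
  -- all coefficients vanish, by induction on the `X₀`-exponent
  have key : ∀ i : ℕ, i < p → ∀ j : ℕ, j < p →
      coeff (Finsupp.single 0 i + Finsupp.single 1 j) (truncQ (Fin 2) K (p ^ 1) g) = 0 := by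
    intro i
    induction i with
    | zero =>
      intro _ j hj
      rw [Finsupp.single_zero, zero_add]
      exact h0 j hj
    | succ i ih =>
      intro hi j hj
      -- relation at `N = (i, j)`
      set N : Fin 2 →₀ ℕ := Finsupp.single 0 i + Finsupp.single 1 j with hNdef
      have hN0 : N 0 = i := by simp [hNdef]
      have hN1 : N 1 = j := by simp [hNdef]
      have hN : InBox (p ^ 1) N := by
        intro k; fin_cases k
        · show N 0 < p ^ 1; rw [hN0, hp1]; omega
        · show N 1 < p ^ 1; rw [hN1, hp1]; omega
      have hrel := coeff_rel_of_heatOp_eq_zero hg N hN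
      -- the left side vanishes by induction (or leaves the box)
      have hL : coeff (N + Finsupp.single 1 2) (truncQ (Fin 2) K (p ^ 1) g) = 0 := by
        by_cases hj2 : j + 2 < p
        · have := ih (by omega) (j + 2) hj2
          rw [hNdef, add_assoc, ← Finsupp.single_add]
          exact this
        · apply coeff_truncQ_eq_zero_of_not_inBox
          intro hbox
          have := hbox 1
          rw [Finsupp.add_apply, hN1, Finsupp.single_eq_same, hp1] at this
          omega
      rw [hL, zero_mul, hN0] at hrel
      have hi1 : ((i : K) + 1) ≠ 0 := by
        have := natCast_ne_zero_of_lt (K := K) (p := p) (Nat.succ_pos i) hi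
        rwa [Nat.cast_succ] at this
      have h3 := hrel.symm
      rw [mul_eq_zero, mul_eq_zero] at h3
      rcases h3 with h3 | h3 | h3
      · exact absurd h3 hw
      · rwa [hNdef, add_right_comm, ← Finsupp.single_add] at h3
      · exact absurd h3 hi1
  apply eq_zero_of_truncQ_eq_zero
  refine MvPolynomial.ext _ _ fun M => ?_
  rw [coeff_zero]
  by_cases hM : InBox (p ^ 1) M
  · have hM' : M = Finsupp.single 0 (M 0) + Finsupp.single 1 (M 1) := by
      ext k; fin_cases k <;> simp
    rw [hM']
    exact key (M 0) (by have := hM 0; rwa [hp1] at this) (M 1) (by have := hM 1; rwa [hp1] at this)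
  · exact coeff_truncQ_eq_zero_of_not_inBox _ hM

/-! ### Weight properties of the heat operator -/

/-- `heatOp` lowers weights by `2`. [folklore] -/
theorem heatOp_mem_wdegIdeal (w : K) {m : ℕ} {z : BoxQuot (Fin 2) K (p ^ 1)}
    (hz : z ∈ wdegIdeal K 2 (p ^ 1) heatWeight m) : heatOp K p w z ∈ wdegIdeal K 2 (p ^ 1) heatWeight (m - 2) := by
  rw [heatOp_apply]
  refine Submodule.sub_mem _ ?_ (Ideal.mul_mem_left _ _ ?_)
  · have h1 := boxDeriv_mem_wdegIdeal heatWeight le_rfl 1 (boxDeriv_mem_wdegIdeal heatWeight le_rfl 1 hz)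
    rw [heatWeight_one] at h1
    exact wdegIdeal_anti heatWeight (by omega) h1
  · have h0 := boxDeriv_mem_wdegIdeal heatWeight le_rfl 0 hz
    rwa [heatWeight_zero] at h0

/-- `heatOp` maps weight-`m` homogeneous classes to weight-`(m−2)` ones (`m ≥ 2`). [folklore] -/
theorem heatOp_mem_whomog (w : K) {m : ℕ} {z : BoxQuot (Fin 2) K (p ^ 1)}
    (hz : z ∈ whomog K 2 (p ^ 1) heatWeight m) (hm : 2 ≤ m) : heatOp K p w z ∈ whomog K 2 (p ^ 1) heatWeight (m - 2) := by
  rw [heatOp_apply]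
  refine Submodule.sub_mem _ ?_ (C_mul_mem_whomog heatWeight ?_ w)
  · have h1 := boxDeriv_mem_whomog heatWeight le_rfl 1 (boxDeriv_mem_whomog heatWeight le_rfl 1 hz)
    rw [heatWeight_one] at h1
    have heq : m - 1 - 1 = m - 2 := by omega
    rwa [heq] at h1
  · have h0 := boxDeriv_mem_whomog heatWeight le_rfl 0 hz
    rwa [heatWeight_zero] at h0

/-- `heatOp` kills homogeneous classes of weight `< 2`. [folklore] -/
theorem heatOp_eq_zero_of_lt (w : K) {m : ℕ} {z : BoxQuot (Fin 2) K (p ^ 1)}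
    (hz : z ∈ whomog K 2 (p ^ 1) heatWeight m) (hm : m < 2) : heatOp K p w z = 0 := by
  rw [heatOp_apply, boxDeriv_eq_zero_of_mem_whomog heatWeight le_rfl 0 hz (by rw [heatWeight_zero]; exact hm),
    mul_zero, sub_zero]
  rcases Nat.lt_or_ge m 1 with h0 | h1
  · rw [boxDeriv_eq_zero_of_mem_whomog heatWeight le_rfl 1 hz (by rw [heatWeight_one]; exact h0), map_zero]
  · have h1' := boxDeriv_mem_whomog heatWeight le_rfl 1 hz
    rw [heatWeight_one] at h1'
    exact boxDeriv_eq_zero_of_mem_whomog heatWeight le_rfl 1 h1' (by rw [heatWeight_one]; omega)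

/-! ### The perturbed operator -/

variable (K p) in
/-- The vector field `∂₁ + ε ∂₀`. [folklore] -/
noncomputable def heatVf (ε : BoxQuot (Fin 2) K (p ^ 1)) : BoxQuot (Fin 2) K (p ^ 1) →ₗ[K] BoxQuot (Fin 2) K (p ^ 1) :=
  boxDeriv K 2 (p ^ 1) 1 + LinearMap.mulLeft K ε ∘ₗ boxDeriv K 2 (p ^ 1) 0

variable (K p) in
/-- **The perturbed heat operator** `(∂₁ + ε∂₀) ∘ (∂₁ + ε∂₀) − ŵ·∂₀`. [folklore] -/
noncomputable def heatPert (ε ŵ : BoxQuot (Fin 2) K (p ^ 1)) :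
    BoxQuot (Fin 2) K (p ^ 1) →ₗ[K] BoxQuot (Fin 2) K (p ^ 1) :=
  heatVf K p ε ∘ₗ heatVf K p ε - LinearMap.mulLeft K ŵ ∘ₗ boxDeriv K 2 (p ^ 1) 0

omit [CharP K p] in
/-- `heatVf` unfolded. [folklore] -/
theorem heatVf_apply (ε z : BoxQuot (Fin 2) K (p ^ 1)) :
    heatVf K p ε z = boxDeriv K 2 (p ^ 1) 1 z + ε * boxDeriv K 2 (p ^ 1) 0 z := rfl

omit [CharP K p] in
/-- `heatPert` unfolded. [folklore] -/
theorem heatPert_apply (ε ŵ z : BoxQuot (Fin 2) K (p ^ 1)) :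
    heatPert K p ε ŵ z = heatVf K p ε (heatVf K p ε z) - ŵ * boxDeriv K 2 (p ^ 1) 0 z := rfl

/-- **The perturbation raises weights**: with `ε` of weight `≥ 2` and `ŵ − w` of weight `≥ 1`,
`(heatPert ε ŵ − heatOp w)` maps `wdegIdeal m` into `wdegIdeal (m − 2 + 1)`. [folklore] -/
theorem heatPert_sub_heatOp_mem {ε ŵ : BoxQuot (Fin 2) K (p ^ 1)} {w : K}
    (hε : ε ∈ wdegIdeal K 2 (p ^ 1) heatWeight 2)
    (hŵ : ŵ - Ideal.Quotient.mk _ (C w) ∈ wdegIdeal K 2 (p ^ 1) heatWeight 1) (m : ℕ) (z : BoxQuot (Fin 2) K (p ^ 1))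
    (hz : z ∈ wdegIdeal K 2 (p ^ 1) heatWeight m) :
    (heatPert K p ε ŵ - heatOp K p w) z ∈ wdegIdeal K 2 (p ^ 1) heatWeight (m - 2 + 1) := by
  set d0 := boxDeriv K 2 (p ^ 1) 0 with hd0
  set d1 := boxDeriv K 2 (p ^ 1) 1 with hd1
  have hexp : (heatPert K p ε ŵ - heatOp K p w) z =
      d1 (ε * d0 z) + ε * d0 (d1 z) + ε * d0 (ε * d0 z) - (ŵ - Ideal.Quotient.mk _ (C w)) * d0 z := by
    rw [LinearMap.sub_apply, heatPert_apply, heatVf_apply, heatVf_apply, heatOp_apply]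
    simp only [map_add]
    ring
  rw [hexp]
  have hW : ∀ (k : ℕ) (y : BoxQuot (Fin 2) K (p ^ 1)), y ∈ wdegIdeal K 2 (p ^ 1) heatWeight k →
      d0 y ∈ wdegIdeal K 2 (p ^ 1) heatWeight (k - 2) ∧ d1 y ∈ wdegIdeal K 2 (p ^ 1) heatWeight (k - 1) :=
    fun k y hy => ⟨by simpa using boxDeriv_mem_wdegIdeal heatWeight le_rfl 0 hy,
      by simpa using boxDeriv_mem_wdegIdeal heatWeight le_rfl 1 hy⟩
  refine Submodule.sub_mem _ (Submodule.add_mem _ (Submodule.add_mem _ ?_ ?_) ?_) ?_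
  · have h1 := (hW _ _ (mul_mem_wdegIdeal heatWeight hε (hW m z hz).1)).2
    exact wdegIdeal_anti heatWeight (by omega) h1
  · have h1 := mul_mem_wdegIdeal heatWeight hε (hW _ _ (hW m z hz).2).1
    exact wdegIdeal_anti heatWeight (by omega) h1
  · have h1 := mul_mem_wdegIdeal heatWeight hε (hW _ _ (mul_mem_wdegIdeal heatWeight hε (hW m z hz).1)).1
    exact wdegIdeal_anti heatWeight (by omega) h1
  · have h1 := mul_mem_wdegIdeal heatWeight hŵ (hW m z hz).1
    exact wdegIdeal_anti heatWeight (by omega) h1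

/-- The index set of the `σ`-coefficients. [folklore] -/
noncomputable def sigmaIdx (p : ℕ) : Finset (Fin 2 →₀ ℕ) :=
  Finset.univ.image fun j : Fin p => Finsupp.single 1 (j : ℕ)

omit [CharP K p] in
/-- There are `p` of them. [folklore] -/
theorem card_sigmaIdx : (sigmaIdx p).card = p := by
  unfold sigmaIdx
  rw [Finset.card_image_of_injective _ (fun j j' h => Fin.ext (Finsupp.single_injective _ h)), Finset.card_univ,
    Fintype.card_fin]

/-- **`dim_K ker (heatPert ε ŵ) ≤ p`** for `ε` of weight `≥ 2`, `ŵ ≡ w ≠ 0` modulo weight `≥ 1`: the leading part is the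
heat operator, whose kernel elements are determined by their `p` coefficients at `σ^j`.
[cite: Mizutani1973HironakaGroupSchemes, Lemma 2.9 (2) (proof outline, p. 94)] -/
theorem finrank_ker_heatPert_le {ε ŵ : BoxQuot (Fin 2) K (p ^ 1)} {w : K} (hw : w ≠ 0)
    (hε : ε ∈ wdegIdeal K 2 (p ^ 1) heatWeight 2)
    (hŵ : ŵ - Ideal.Quotient.mk _ (C w) ∈ wdegIdeal K 2 (p ^ 1) heatWeight 1) :
    Module.finrank K (LinearMap.ker (heatPert K p ε ŵ)) ≤ p := by
  have key := finrank_ker_le_card_of_initialForm heatWeight (Ψ := heatPert K p ε ŵ) (Q₀ := heatOp K p w) (d := 2)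
    (fun m z hz hm => heatOp_mem_whomog w hz hm) (fun m z hz hm => heatOp_eq_zero_of_lt w hz hm)
    (fun m z hz => heatOp_mem_wdegIdeal w hz) (heatPert_sub_heatOp_mem hε hŵ) (sigmaIdx p)
    (fun g hg hcoef => eq_zero_of_heatOp_eq_zero hw hg fun j hj =>
      hcoef _ (Finset.mem_image.mpr ⟨⟨j, hj⟩, Finset.mem_univ _, rfl⟩))
  rwa [card_sigmaIdx] at key

end Heat

end Summit.ResolutionOfSingularities.KangarooAtlas.Mizutani
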